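import Literature.NumberTheory.Sieve.LargeSieveAPVariance
import Literature.NumberTheory.Sieve.BombieriVinogradovReduction
import Literature.NumberTheory.Sieve.BDHVarianceLowerBound
import HarnessLib

/-!
# Tools for the Barban–Davenport–Halberstam theorem: the class variance in character form, the
# primitive large-sieve half for ALL moduli, induced characters vs inducers for `ψ(x,χ)`, and the count of
# small conductors

For the centred variance `V(x,Q) = ∑_{h ≤ Q} ∑*_{a (h)} (ψ(x;h,a) − ψ_h(x)/φ(h))²` of the primes in arithmetic
progressions (`BDHVariance.bdhVariance`, typed with Harper–Soundararajan's LOWER bound as a named fact in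
`BDHVarianceLowerBound`), the classical UPPER bound (Davenport ch. 29) rests on four elementary steps, proved here:

* `classVarianceAt_eq_charForm` — orthogonality/Parseval: `∑*_{a} (ψ(x;h,a) − ψ_h/φ(h))² = φ(h)⁻¹ ∑_{χ ≠ χ₀} |ψ(x,χ)|²`
  (`ψ(x,χ) = chebyshevPsiChar χ x`; via the tree's `chebyshevPsiChar_eq_sum_units` and
  `LargeSieve.sum_units_norm_sq_charComb`);
* `sum_totient_inv_largeConductor_prim_le` — the large-sieve half over all moduli in PRIMITIVE form (no coprimality
  hypothesis): `∑_{h≤Q} φ(h)⁻¹ ∑_{(d,ψ)∈S(h), d>R} |∑_n a_n ψ(n)|² ≤ (1+log Q)²(2(N+1)/R + 4Q) ∑|a_n|²`;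
* `norm_chebyshevPsiChar_induce_le` — `|ψ(x, χ)| ≤ |ψ(x, χ*)| + R(h,x)` for `χ` mod `h` induced by `χ*`
  (`R(h,x) = nonCoprimePart h x ≤ (log x/log 2)·log h`);
* `card_primIndex_filter_le` — `#{(d,ψ) ∈ S(h) : d ≤ R} ≤ R²`.

Pure bookkeeping over landed identities; standard axioms.

## References
* [Davenport1980] ch. 29 (Barban–Davenport–Halberstam) — derivation.
* [IwaniecKowalski2004] §17.3 — derivation.
-/

noncomputable section

open Finset Real Complex
open scoped ArithmeticFunction.vonMangoldt

namespace Literature.NumberTheory.Sieve.BDH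

open LargeSieve BDHVariance

/-! ### §1. `ψ(x;h,a)` and `ψ(x,χ)`: inverse orthogonality and the variance in character form -/

section CharForm

variable {h : ℕ} [NeZero h]

/-- **Inverse orthogonality**: for a reduced class `c` mod `h`,
`φ(h)·ψ(x;h,c) = ∑_{χ mod h} χ(c⁻¹) ψ(x,χ)`. [cite: Davenport1980, ch. 29 — derivation] -/
theorem totient_mul_chebyshevPsiMod_eq (c : (ZMod h)ˣ) (x : ℝ) :
    (h.totient : ℂ) * (ParityWave0.chebyshevPsiMod h (c : ZMod h) x : ℂ) =
      ∑ χ : DirichletCharacter ℂ h, χ ((c⁻¹ : (ZMod h)ˣ) : ZMod h) * chebyshevPsiChar χ x := by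
  have horth : ∀ a : (ZMod h)ˣ, ∑ χ : DirichletCharacter ℂ h,
      χ ((c⁻¹ : (ZMod h)ˣ) : ZMod h) * χ (a : ZMod h) =
        if ((c : (ZMod h)ˣ) : ZMod h) = (a : ZMod h) then (h.totient : ℂ) else 0 := by
    intro a
    rw [← ZMod.inv_coe_unit]
    exact DirichletCharacter.sum_char_inv_mul_char_eq ℂ (Units.isUnit c) (a : ZMod h)
  calc (h.totient : ℂ) * (ParityWave0.chebyshevPsiMod h (c : ZMod h) x : ℂ)
      = ∑ a : (ZMod h)ˣ, (if ((c : (ZMod h)ˣ) : ZMod h) = (a : ZMod h) then (h.totient : ℂ) else 0) *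
          (ParityWave0.chebyshevPsiMod h (a : ZMod h) x : ℂ) := by
        rw [Finset.sum_eq_single c]
        · simp
        · intro a _ hac
          rw [if_neg, zero_mul]
          exact fun hca ↦ hac (Units.ext hca.symm)
        · intro hc; exact absurd (Finset.mem_univ c) hc
    _ = ∑ a : (ZMod h)ˣ, ∑ χ : DirichletCharacter ℂ h,
          χ ((c⁻¹ : (ZMod h)ˣ) : ZMod h) * χ (a : ZMod h) * (ParityWave0.chebyshevPsiMod h (a : ZMod h) x : ℂ) := by
        refine Finset.sum_congr rfl fun a _ ↦ ?_
        rw [← horth a, Finset.sum_mul]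
    _ = ∑ χ : DirichletCharacter ℂ h, ∑ a : (ZMod h)ˣ,
          χ ((c⁻¹ : (ZMod h)ˣ) : ZMod h) * χ (a : ZMod h) * (ParityWave0.chebyshevPsiMod h (a : ZMod h) x : ℂ) :=
        Finset.sum_comm
    _ = ∑ χ : DirichletCharacter ℂ h, χ ((c⁻¹ : (ZMod h)ˣ) : ZMod h) * chebyshevPsiChar χ x := by
        refine Finset.sum_congr rfl fun χ _ ↦ ?_
        rw [chebyshevPsiChar_eq_sum_units, Finset.mul_sum]
        exact Finset.sum_congr rfl fun a _ ↦ by ring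

/-- `ψ(x, χ₀) = ψ_h(x) = ∑*_{a} ψ(x;h,a)` for the trivial character `χ₀` mod `h`.
[cite: Davenport1980, ch. 29 — derivation] -/
theorem chebyshevPsiChar_one_eq_psiCoprime (x : ℝ) :
    chebyshevPsiChar (1 : DirichletCharacter ℂ h) x = (psiCoprime h x : ℂ) := by
  rw [chebyshevPsiChar_eq_sum_units, psiCoprime, Complex.ofReal_sum]
  refine Finset.sum_congr rfl fun a _ ↦ ?_
  rw [MulChar.one_apply_coe, one_mul]

open scoped Classical in
/-- The centred class count as a character sum over the non-trivial characters:
`ψ(x;h,c) − ψ_h(x)/φ(h) = φ(h)⁻¹ ∑_{χ ≠ χ₀} χ(c⁻¹) ψ(x,χ)` (as complex numbers).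
[cite: Davenport1980, ch. 29 — derivation] -/
theorem chebyshevPsiMod_sub_eq_charSum (c : (ZMod h)ˣ) (x : ℝ) :
    ((ParityWave0.chebyshevPsiMod h (c : ZMod h) x - psiCoprime h x / (h.totient : ℝ) : ℝ) : ℂ) =
      ((h.totient : ℂ))⁻¹ * ∑ χ ∈ (Finset.univ : Finset (DirichletCharacter ℂ h)).filter (fun χ => χ ≠ 1),
        χ ((c⁻¹ : (ZMod h)ˣ) : ZMod h) * chebyshevPsiChar χ x := by
  have hφ : (h.totient : ℂ) ≠ 0 := by exact_mod_cast (Nat.totient_pos.2 (NeZero.pos h)).ne'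
  have hsplit : ∑ χ : DirichletCharacter ℂ h, χ ((c⁻¹ : (ZMod h)ˣ) : ZMod h) * chebyshevPsiChar χ x =
      chebyshevPsiChar (1 : DirichletCharacter ℂ h) x +
        ∑ χ ∈ (Finset.univ : Finset (DirichletCharacter ℂ h)).filter (fun χ => χ ≠ 1),
          χ ((c⁻¹ : (ZMod h)ˣ) : ZMod h) * chebyshevPsiChar χ x := by
    rw [← Finset.sum_filter_add_sum_filter_not Finset.univ (fun χ : DirichletCharacter ℂ h => χ = 1),
      Finset.filter_eq' Finset.univ (1 : DirichletCharacter ℂ h), if_pos (Finset.mem_univ _),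
      Finset.sum_singleton, MulChar.one_apply_coe, one_mul]
  have key := totient_mul_chebyshevPsiMod_eq c x
  rw [hsplit, chebyshevPsiChar_one_eq_psiCoprime] at key
  push_cast
  field_simp
  linear_combination key

open scoped Classical in
/-- **The class variance in character form** (orthogonality / Parseval):
`∑*_{a (h)} (ψ(x;h,a) − ψ_h(x)/φ(h))² = φ(h)⁻¹ ∑_{χ mod h, χ ≠ χ₀} |ψ(x,χ)|²`.
[cite: Davenport1980, ch. 29 — derivation] -/
theorem classVarianceAt_eq_charForm (x : ℝ) :
    classVarianceAt h x = ((h.totient : ℝ))⁻¹ *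
      ∑ χ ∈ (Finset.univ : Finset (DirichletCharacter ℂ h)).filter (fun χ => χ ≠ 1),
        ‖chebyshevPsiChar χ x‖ ^ 2 := by
  have hφ0 : (0 : ℝ) < h.totient := by exact_mod_cast Nat.totient_pos.2 (NeZero.pos h)
  set T := (Finset.univ : Finset (DirichletCharacter ℂ h)).filter (fun χ => χ ≠ 1) with hT
  rw [classVarianceAt, dif_neg (NeZero.ne h)]
  -- each squared real deviation is the squared norm of the complex character sum
  have hterm : ∀ c : (ZMod h)ˣ,
      (ParityWave0.chebyshevPsiMod h (c : ZMod h) x - psiCoprime h x / (h.totient : ℝ)) ^ 2 =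
        ‖∑ χ ∈ T, χ ((c⁻¹ : (ZMod h)ˣ) : ZMod h) * (((h.totient : ℂ))⁻¹ * chebyshevPsiChar χ x)‖ ^ 2 := by
    intro c
    have h1 : ∑ χ ∈ T, χ ((c⁻¹ : (ZMod h)ˣ) : ZMod h) * (((h.totient : ℂ))⁻¹ * chebyshevPsiChar χ x) =
        ((h.totient : ℂ))⁻¹ * ∑ χ ∈ T, χ ((c⁻¹ : (ZMod h)ˣ) : ZMod h) * chebyshevPsiChar χ x := by
      rw [Finset.mul_sum]
      exact Finset.sum_congr rfl fun χ _ ↦ by ring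
    rw [h1, ← chebyshevPsiMod_sub_eq_charSum c x, Complex.norm_real, Real.norm_eq_abs, sq_abs]
  simp_rw [hterm]
  rw [sum_units_norm_sq_charComb T (fun χ => ((h.totient : ℂ))⁻¹ * chebyshevPsiChar χ x)]
  simp_rw [norm_mul, mul_pow, norm_inv, Complex.norm_natCast, ← Finset.mul_sum]
  field_simp

end CharForm

/-! ### §2. The primitive large-sieve half for all moduli (no coprimality hypothesis) -/

open scoped Classical in
/-- **The large-sieve half of Barban–Davenport–Halberstam, primitive form.** For complex `a_n` on `(M₀, M₀ + N]`
and `1 ≤ R`: `∑_{h ≤ Q} φ(h)⁻¹ ∑_{(d,ψ) ∈ S(h), d > R} |∑_n a_n ψ(n)|² ≤ (1 + log Q)²·(2(N+1)/R + 4Q)·∑_n |a_n|²`,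
the inner sums taken against the PRIMITIVE inducers `ψ` (`S(h) = primIndex h`). No hypothesis on the support of `a`.
[cite: Davenport1980, ch. 29 — derivation; IwaniecKowalski2004, Thm 7.13 — derivation] -/
theorem sum_totient_inv_largeConductor_prim_le (a : ℕ → ℂ) (M₀ N R Q : ℕ) (hR : 1 ≤ R) :
    ∑ h ∈ Icc 1 Q, ((h.totient : ℝ))⁻¹ *
        ∑ σ ∈ (primIndex h).filter (fun σ => R < σ.1), ‖∑ n ∈ Ioc M₀ (M₀ + N), a n * σ.2 n‖ ^ 2 ≤
      (1 + Real.log Q) ^ 2 * (2 * ((N : ℝ) + 1) / R + 4 * Q) * ∑ n ∈ Ioc M₀ (M₀ + N), ‖a n‖ ^ 2 := by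
  classical
  set S := ∑ n ∈ Ioc M₀ (M₀ + N), ‖a n‖ ^ 2 with hS
  have hS0 : 0 ≤ S := Finset.sum_nonneg fun _ _ => by positivity
  set P : ℕ → ℝ := fun d =>
    ∑ ψ : DirichletCharacter ℂ d with ψ.IsPrimitive, ‖∑ n ∈ Ioc M₀ (M₀ + N), a n * ψ n‖ ^ 2 with hP
  set F : ℕ → ℝ := fun d => if R < d then P d else 0 with hF
  have hP0 : ∀ d, 0 ≤ P d := fun d => Finset.sum_nonneg fun _ _ => by positivity
  have hF0 : ∀ d, 0 ≤ F d := fun d => by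
    simp only [hF]; split_ifs
    · exact hP0 d
    · exact le_rfl
  have hinner : ∀ h ∈ Icc 1 Q,
      ∑ σ ∈ (primIndex h).filter (fun σ => R < σ.1), ‖∑ n ∈ Ioc M₀ (M₀ + N), a n * σ.2 n‖ ^ 2 =
        ∑ d ∈ h.divisors, F d := by
    intro h _
    rw [Finset.sum_filter, primIndex, Finset.sum_sigma]
    refine Finset.sum_congr rfl fun d _ => ?_
    simp only [hF, hP]
    by_cases hRd : R < d
    · simp only [hRd, if_true]
    · simp only [hRd, if_false, Finset.sum_const_zero]
  have hswap : ∑ h ∈ Icc 1 Q, ((h.totient : ℝ))⁻¹ * ∑ d ∈ h.divisors, F d =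
      ∑ d ∈ Icc 1 Q, F d * ∑ h ∈ Icc 1 Q with d ∣ h, ((h.totient : ℝ))⁻¹ :=
    sum_mul_sum_divisors_eq Q (fun h => ((h.totient : ℝ))⁻¹) F
  have hW : ∀ d ∈ Icc 1 Q, F d * ∑ h ∈ Icc 1 Q with d ∣ h, ((h.totient : ℝ))⁻¹ ≤
      totientInvSum Q * (((d.totient : ℝ))⁻¹ * F d) := by
    intro d hd
    have hd1 : 1 ≤ d := (mem_Icc.1 hd).1
    calc F d * ∑ h ∈ Icc 1 Q with d ∣ h, ((h.totient : ℝ))⁻¹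
        ≤ F d * (((d.totient : ℝ))⁻¹ * totientInvSum Q) :=
          mul_le_mul_of_nonneg_left (sum_filter_dvd_totient_inv_le Q hd1) (hF0 d)
      _ = totientInvSum Q * (((d.totient : ℝ))⁻¹ * F d) := by ring
  have hrange : ∑ d ∈ Icc 1 Q, ((d.totient : ℝ))⁻¹ * F d = ∑ d ∈ Ioc R Q, ((d.totient : ℝ))⁻¹ * P d := by
    have hsub : Ioc R Q ⊆ Icc 1 Q := fun d hd => by
      simp only [mem_Ioc, mem_Icc] at hd ⊢; omega
    rw [← Finset.sum_subset hsub]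
    · refine Finset.sum_congr rfl fun d hd => ?_
      simp only [hF, (mem_Ioc.1 hd).1, if_true]
    · intro d hd hdn
      have : ¬ R < d := fun h' => hdn (mem_Ioc.2 ⟨h', (mem_Icc.1 hd).2⟩)
      simp only [hF, this, if_false, mul_zero]
  have hlog : 0 ≤ 1 + Real.log Q := by
    have := Real.log_natCast_nonneg Q; linarith
  calc ∑ h ∈ Icc 1 Q, ((h.totient : ℝ))⁻¹ *
          ∑ σ ∈ (primIndex h).filter (fun σ => R < σ.1), ‖∑ n ∈ Ioc M₀ (M₀ + N), a n * σ.2 n‖ ^ 2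
      = ∑ h ∈ Icc 1 Q, ((h.totient : ℝ))⁻¹ * ∑ d ∈ h.divisors, F d :=
        Finset.sum_congr rfl fun h hh => by rw [hinner h hh]
    _ = ∑ d ∈ Icc 1 Q, F d * ∑ h ∈ Icc 1 Q with d ∣ h, ((h.totient : ℝ))⁻¹ := hswap
    _ ≤ ∑ d ∈ Icc 1 Q, totientInvSum Q * (((d.totient : ℝ))⁻¹ * F d) := Finset.sum_le_sum hW
    _ = totientInvSum Q * ∑ d ∈ Ioc R Q, ((d.totient : ℝ))⁻¹ * P d := by
        rw [← Finset.mul_sum, hrange]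
    _ ≤ (1 + Real.log Q) ^ 2 * ((2 * ((N : ℝ) + 1) / R + 4 * Q) * S) := by
        refine mul_le_mul (totientInvSum_le Q) ?_ ?_ (by positivity)
        · exact largeSieve_character_totient_tail a M₀ N R Q hR
        · exact Finset.sum_nonneg fun d _ => mul_nonneg (inv_nonneg.2 (Nat.cast_nonneg _)) (hP0 d)
    _ = (1 + Real.log Q) ^ 2 * (2 * ((N : ℝ) + 1) / R + 4 * Q) * S := by ring

/-! ### §3. `ψ(x,χ)` over `(0, ⌊x⌋]`, induced characters vs inducers, and the small-conductor count -/

/-- `ψ(x, χ) = ∑_{0 < n ≤ ⌊x⌋} Λ(n) χ(n)` (the `n = 0` term of `chebyshevPsiChar` vanishes).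
[cite: Davenport1980, ch. 29 — derivation] -/
theorem chebyshevPsiChar_eq_sum_Ioc {d : ℕ} (χ : DirichletCharacter ℂ d) (x : ℝ) :
    chebyshevPsiChar χ x = ∑ n ∈ Ioc 0 ⌊x⌋₊, ((Λ n : ℝ) : ℂ) * χ n := by
  rw [chebyshevPsiChar, sum_range_succ_eq_sum_Ioc' _ (by simp)]
  exact Finset.sum_congr rfl fun n _ => mul_comm _ _

open scoped Classical in
/-- **Induced character vs inducer**: for `(d, ψ) ∈ S(h)`, `|ψ(x, induce h (d,ψ))| ≤ |ψ(x, ψ)| + R(h, x)`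
(`R = nonCoprimePart`: the prime powers `p^k ≤ x`, `p ∣ h`). [cite: Davenport1980, ch. 29 — derivation] -/
theorem norm_chebyshevPsiChar_induce_le {h : ℕ} [NeZero h] {σ : Σ d : ℕ, DirichletCharacter ℂ d}
    (hσ : σ ∈ primIndex h) (x : ℝ) :
    ‖chebyshevPsiChar (induce h σ) x‖ ≤ ‖chebyshevPsiChar σ.2 x‖ + nonCoprimePart h x := by
  obtain ⟨hd, -, -⟩ := mem_primIndex.1 hσ
  rw [induce, dif_pos hd]
  calc ‖chebyshevPsiChar (DirichletCharacter.changeLevel hd σ.2) x‖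
      = ‖chebyshevPsiChar σ.2 x +
          (chebyshevPsiChar (DirichletCharacter.changeLevel hd σ.2) x - chebyshevPsiChar σ.2 x)‖ := by
        rw [add_sub_cancel]
    _ ≤ ‖chebyshevPsiChar σ.2 x‖ +
          ‖chebyshevPsiChar (DirichletCharacter.changeLevel hd σ.2) x - chebyshevPsiChar σ.2 x‖ :=
        norm_add_le _ _
    _ ≤ ‖chebyshevPsiChar σ.2 x‖ + nonCoprimePart h x := by
        gcongr; exact norm_chebyshevPsiChar_changeLevel_sub_le hd σ.2 x

open scoped Classical in
/-- **Few characters of small conductor**: `#{(d,ψ) ∈ S(h) : d ≤ R} ≤ R²` (for each `d ≤ R` at most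
`φ(d) ≤ d ≤ R` primitive characters). [cite: Davenport1980, ch. 29 — derivation] -/
theorem card_primIndex_filter_le (h R : ℕ) :
    ((primIndex h).filter (fun σ => σ.1 ≤ R)).card ≤ R * R := by
  classical
  have hsub : (primIndex h).filter (fun σ => σ.1 ≤ R) ⊆
      (Finset.Icc 1 R).sigma (fun d => (Finset.univ : Finset (DirichletCharacter ℂ d))) := by
    intro σ hσ
    rw [Finset.mem_filter] at hσ
    obtain ⟨hmem, hle⟩ := hσ
    obtain ⟨hdvd, hq, -⟩ := mem_primIndex.1 hmem
    rw [Finset.mem_sigma]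
    refine ⟨Finset.mem_Icc.2 ⟨?_, hle⟩, Finset.mem_univ _⟩
    exact Nat.pos_of_dvd_of_pos hdvd (Nat.pos_of_ne_zero hq)
  refine (Finset.card_le_card hsub).trans ?_
  rw [Finset.card_sigma]
  calc ∑ d ∈ Icc 1 R, (Finset.univ : Finset (DirichletCharacter ℂ d)).card
      ≤ ∑ d ∈ Icc 1 R, R := Finset.sum_le_sum fun d hd => by
        have hd1 : 1 ≤ d := (Finset.mem_Icc.1 hd).1
        haveI : NeZero d := ⟨by omega⟩
        rw [Finset.card_univ, ← Nat.card_eq_fintype_card,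
          DirichletCharacter.card_eq_totient_of_hasEnoughRootsOfUnity ℂ d]
        exact (Nat.totient_le d).trans (Finset.mem_Icc.1 hd).2
    _ = R * R := by rw [Finset.sum_const, Nat.card_Icc, smul_eq_mul, Nat.add_sub_cancel]

end Literature.NumberTheory.Sieve.BDH
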